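import Mathlib
import Summits.NavierStokesRegularity.NavierStokesRegularity.Theorems.ThreadingFluxHorizonTowerMixedBracketCoreC
import HarnessLib

/-!
# Crux `PoloidalLiouville` (stmt-NavierStokesRegularity-1222, W1/W2), crux idea «horizon-threading-tower» (ns-idea-15):
# MIXED-DEGREE BRACKET RIGIDITY, core D — the degenerate branch dies; `det(∇A, ∇|∇A|², x) ≡ 0`

Support file (Theorems-side tooling; seat ns-wall-eng-3 g3, cell ns-wall-extremal, W1 adjunct; `--supports
stmt-NavierStokesRegularity-1222`, helper).  Part of the kernel proof of ★ MIXED-DEGREE BRACKET RIGIDITY: two non-zero real solid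
harmonics `A`, `B` on `ℝ³` of DIFFERENT degrees `l ≠ m` whose loop bracket `det(x, ∇A, ∇B)` vanishes identically are zonal about a
common axis — equivalently (ns-idea-15 «horizon-threading-tower», `OrderOneSphereEuler`): a TWO-SHELL scale-free profile
`U = U_{H_l} + U_{H_m}` passes the ORDER-ONE horizon law only if it is axisymmetric without swirl (the two-shell case of the conjecture
`HorizonTower.HorizonTowerZonality` at order one).  METHOD (pure polynomial algebra in `ℝ[x₀,x₁,x₂]`, formal partial derivatives):
Cramer decomposition `|x×∇A|²·∇B = P₁ x + P₂ ∇A`; its curl (⇒ `P₁/|x×∇A|²`, `P₂/|x×∇A|²` are first integrals of `L = (x × ∇A)·∇`)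
and divergence; the gradient of `β = P₂/|x×∇A|²` decomposed once more (`|x×∇A|²·∇β ∝ c₁ x + M ∇A`) and its curl; then
`L` applied to the divergence identity gives `N · ρ · det(∇A, ∇|∇A|², x) = 0` in the domain `ℝ[x]` with `N = (m+1)ρP₁ + l(m−l)AP₂`;
the branch `N = 0` forces `A∇B − B∇A` radial and dies on `(m−l)(l+m+1)AB = 0`; so `A` is det-zonal, hence zonal by ns-wall-eng-5 g4's
`Zonal.detZonal_allDegrees` machinery, and `B` follows by `Zonal.zonal_partner_of_bracket` (p688869).
HONEST LABEL: algebra toward one crux idea's typed conjecture; `HorizonTowerZonality` (general profiles), `PoloidalLiouville` (1222),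
`UnthreadedRigidity` (27585), 23843 and NS regularity remain OPEN; W1/W2 movement 0.  [folklore]
-/

-- the summit and its single problem share the name (D-0017 nested layout)
set_option linter.dupNamespace false

noncomputable section

open MvPolynomial Finsupp

namespace Summit.NavierStokesRegularity.NavierStokesRegularity.Theorems.PoloidalLiouville.HorizonTower.Zonal

section Stages

variable {l m : ℕ} {A B : RPoly}

/-- Stage N2: on the branch `N = 0`, `m(m+1)·Wq·(∇B × x) = l(l+1)·P₂·(∇A × x)` componentwise. -/
theorem stageN2 (hl : 1 ≤ l) (hm : 1 ≤ m) (hA : A.IsHomogeneous l) (hB : B.IsHomogeneous m)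
    (hlA : lapP A = 0) (hlB : lapP B = 0) (hA0 : A ≠ 0) (hD : detP A B = 0) (hN0 : nn l m A B = 0) :
    C (m : ℝ) * (C (m : ℝ) + 1) * wq l A * (pderiv 0 B * X 1 - pderiv 1 B * X 0) = C (l : ℝ) * (C (l : ℝ) + 1) * ptwo l m A B * (pderiv 0 A * X 1 - pderiv 1 A * X 0) ∧
    C (m : ℝ) * (C (m : ℝ) + 1) * wq l A * (pderiv 1 B * X 2 - pderiv 2 B * X 1) = C (l : ℝ) * (C (l : ℝ) + 1) * ptwo l m A B * (pderiv 1 A * X 2 - pderiv 2 A * X 1) ∧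
    C (m : ℝ) * (C (m : ℝ) + 1) * wq l A * (pderiv 2 B * X 0 - pderiv 0 B * X 2) = C (l : ℝ) * (C (l : ℝ) + 1) * ptwo l m A B * (pderiv 2 A * X 0 - pderiv 0 A * X 2) := by
  obtain ⟨Q0, Q1, Q2⟩ := stageQ hA hB hlA hlB hD
  obtain ⟨E1', hM0⟩ := stageN1 hl hm hA hB hlA hlB hD hN0
  set a0 := pderiv 0 A with ha0
  set a1 := pderiv 1 A with ha1
  set a2 := pderiv 2 A with ha2
  set b0 := pderiv 0 B with hb0
  set b1 := pderiv 1 B with hb1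
  set b2 := pderiv 2 B with hb2
  set ρ : RPoly := rhoP with hρ'
  set G : RPoly := gP A with hG'
  set H : RPoly := hP A B with hH'
  set Wq : RPoly := wq l A with hWq'
  set P₁ : RPoly := pone l m A B with hP₁'
  set P₂ : RPoly := ptwo l m A B with hP₂'
  have hρ : ρ = X 0 ^ 2 + X 1 ^ 2 + X 2 ^ 2 := by rw [hρ']; rfl
  have hG : G = a0 * a0 + a1 * a1 + a2 * a2 := by rw [hG', ha0, ha1, ha2]; rfl
  have hH : H = a0 * b0 + a1 * b1 + a2 * b2 := by rw [hH', ha0, ha1, ha2, hb0, hb1, hb2]; rfl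
  have hWq : Wq = ρ * G - C (l : ℝ) * C (l : ℝ) * A * A := by rw [hWq', hρ', hG']; rfl
  have hP₁ : P₁ = C (m : ℝ) * B * G - C (l : ℝ) * A * H := by rw [hP₁', hG', hH']; rfl
  have hP₂ : P₂ = ρ * H - C (l : ℝ) * C (m : ℝ) * A * B := by rw [hP₂', hρ', hH']; rfl
  have sa01 : pderiv 1 a0 = pderiv 0 a1 := by rw [ha0, ha1, pderiv_comm_real]
  have sa02 : pderiv 2 a0 = pderiv 0 a2 := by rw [ha0, ha2, pderiv_comm_real]
  have sa12 : pderiv 2 a1 = pderiv 1 a2 := by rw [ha1, ha2, pderiv_comm_real]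
  have sb01 : pderiv 1 b0 = pderiv 0 b1 := by rw [hb0, hb1, pderiv_comm_real]
  have sb02 : pderiv 2 b0 = pderiv 0 b2 := by rw [hb0, hb2, pderiv_comm_real]
  have sb12 : pderiv 2 b1 = pderiv 1 b2 := by rw [hb1, hb2, pderiv_comm_real]
  have lapA : pderiv 0 a0 + pderiv 1 a1 + pderiv 2 a2 = 0 := by rw [ha0, ha1, ha2]; exact hlA
  have lapB : pderiv 0 b0 + pderiv 1 b1 + pderiv 2 b2 = 0 := by rw [hb0, hb1, hb2]; exact hlB
  have eA : X 0 * a0 + X 1 * a1 + X 2 * a2 = C (l : ℝ) * A := by rw [ha0, ha1, ha2, euler3 hA]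
  have eB : X 0 * b0 + X 1 * b1 + X 2 * b2 = C (m : ℝ) * B := by rw [hb0, hb1, hb2, euler3 hB]
  have hD' : (X 1 * a2 - X 2 * a1) * b0 + (X 2 * a0 - X 0 * a2) * b1 + (X 0 * a1 - X 1 * a0) * b2 = 0 := by
    rw [ha0, ha1, ha2, hb0, hb1, hb2, ← detP_eq_w, hD]
  have LdP : ∀ Q : RPoly, detP A Q = (X 1 * a2 - X 2 * a1) * pderiv 0 Q + (X 2 * a0 - X 0 * a2) * pderiv 1 Q
      + (X 0 * a1 - X 1 * a0) * pderiv 2 Q := fun Q => by rw [detP_eq_w]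
  set p0 := pv l m A B 0 with hp0'
  set p1 := pv l m A B 1 with hp1'
  set p2 := pv l m A B 2 with hp2'
  have hp0 : p0 = Wq * pderiv 0 P₂ - P₂ * pderiv 0 Wq := by rw [hp0', hWq', hP₂']; rfl
  have hp1 : p1 = Wq * pderiv 1 P₂ - P₂ * pderiv 1 Wq := by rw [hp1', hWq', hP₂']; rfl
  have hp2 : p2 = Wq * pderiv 2 P₂ - P₂ * pderiv 2 Wq := by rw [hp2', hWq', hP₂']; rfl
  set PX := pxs l m A B with hPX'
  set PA := pas l m A B with hPA'
  have hPX : PX = X 0 * p0 + X 1 * p1 + X 2 * p2 := by rw [hPX', hp0', hp1', hp2']; rfl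
  have hPA : PA = a0 * p0 + a1 * p1 + a2 * p2 := by rw [hPA', ha0, ha1, ha2, hp0', hp1', hp2']; rfl
  set c₁ := cone l m A B with hc₁'
  set M := mm l m A B with hM'
  have hc₁ : c₁ = PX * G - PA * (C (l : ℝ) * A) := by rw [hc₁', hPX', hPA', hG']; rfl
  have hM : M = PA * ρ - PX * (C (l : ℝ) * A) := by rw [hM', hPX', hPA', hρ']; rfl
  have hWq0 : Wq ≠ 0 := by
    rw [hWq, hρ, hG, ha0, ha1, ha2]; exact wq_ne_zero hA hl hlA hA0
  have px01 : p0 * X 1 - p1 * X 0 = 0 := by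
    have h : Wq * (p0 * X 1 - p1 * X 0) = Wq * 0 := by linear_combination X 1 * Q0 - X 0 * Q1 + (a0 * X 1 - a1 * X 0) * hM0
    exact mul_left_cancel₀ hWq0 h
  have px12 : p1 * X 2 - p2 * X 1 = 0 := by
    have h : Wq * (p1 * X 2 - p2 * X 1) = Wq * 0 := by linear_combination X 2 * Q1 - X 1 * Q2 + (a1 * X 2 - a2 * X 1) * hM0
    exact mul_left_cancel₀ hWq0 h
  have px20 : p2 * X 0 - p0 * X 2 = 0 := by
    have h : Wq * (p2 * X 0 - p0 * X 2) = Wq * 0 := by linear_combination X 0 * Q2 - X 2 * Q0 + (a2 * X 0 - a0 * X 2) * hM0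
    exact mul_left_cancel₀ hWq0 h
  have d0 := congrArg (pderiv 0) E1'
  have d1 := congrArg (pderiv 1) E1'
  have d2 := congrArg (pderiv 2) E1'
  simp only [Derivation.leibniz, smul_eq_mul, pderiv_C, map_add, Derivation.map_one_eq_zero, mul_zero, add_zero] at d0 d1 d2
  rw [← ha0, ← hb0] at d0
  rw [← ha1, ← hb1] at d1
  rw [← ha2, ← hb2] at d2
  have g0 : C (l : ℝ) * (C (l : ℝ) + 1) * A * p0 = Wq * (C (m : ℝ) * (C (m : ℝ) + 1) * Wq * b0 - C (l : ℝ) * (C (l : ℝ) + 1) * P₂ * a0) := by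
    rw [hp0]; linear_combination (-Wq) * d0 + pderiv 0 Wq * E1'
  have g1 : C (l : ℝ) * (C (l : ℝ) + 1) * A * p1 = Wq * (C (m : ℝ) * (C (m : ℝ) + 1) * Wq * b1 - C (l : ℝ) * (C (l : ℝ) + 1) * P₂ * a1) := by
    rw [hp1]; linear_combination (-Wq) * d1 + pderiv 1 Wq * E1'
  have g2 : C (l : ℝ) * (C (l : ℝ) + 1) * A * p2 = Wq * (C (m : ℝ) * (C (m : ℝ) + 1) * Wq * b2 - C (l : ℝ) * (C (l : ℝ) + 1) * P₂ * a2) := by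
    rw [hp2]; linear_combination (-Wq) * d2 + pderiv 2 Wq * E1'
  refine ⟨?_, ?_, ?_⟩
  · have h : Wq * (C (m : ℝ) * (C (m : ℝ) + 1) * Wq * (b0 * X 1 - b1 * X 0) - C (l : ℝ) * (C (l : ℝ) + 1) * P₂ * (a0 * X 1 - a1 * X 0)) = Wq * 0 := by
      linear_combination X 0 * g1 - X 1 * g0 + C (l : ℝ) * (C (l : ℝ) + 1) * A * px01
    have h2 := mul_left_cancel₀ hWq0 h
    linear_combination h2
  · have h : Wq * (C (m : ℝ) * (C (m : ℝ) + 1) * Wq * (b1 * X 2 - b2 * X 1) - C (l : ℝ) * (C (l : ℝ) + 1) * P₂ * (a1 * X 2 - a2 * X 1)) = Wq * 0 := by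
      linear_combination X 1 * g2 - X 2 * g1 + C (l : ℝ) * (C (l : ℝ) + 1) * A * px12
    have h2 := mul_left_cancel₀ hWq0 h
    linear_combination h2
  · have h : Wq * (C (m : ℝ) * (C (m : ℝ) + 1) * Wq * (b2 * X 0 - b0 * X 2) - C (l : ℝ) * (C (l : ℝ) + 1) * P₂ * (a2 * X 0 - a0 * X 2)) = Wq * 0 := by
      linear_combination X 2 * g0 - X 0 * g2 + C (l : ℝ) * (C (l : ℝ) + 1) * A * px20
    have h2 := mul_left_cancel₀ hWq0 h
    linear_combination h2

/-- Stage N3: the branch `N = 0` is impossible — `A(∇B × x) = B(∇A × x)`, then `ρ(A∇B − B∇A) = (m−l)AB·x`, whose divergence gives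
`(m−l)(l+m+1)AB = 0`. -/
theorem stageN3 (hl : 1 ≤ l) (hm : 1 ≤ m) (hlm : l ≠ m) (hA : A.IsHomogeneous l) (hB : B.IsHomogeneous m)
    (hlA : lapP A = 0) (hlB : lapP B = 0) (hA0 : A ≠ 0) (hB0 : B ≠ 0) (hD : detP A B = 0) (hN0 : nn l m A B = 0) :
    False := by
  obtain ⟨E1', -⟩ := stageN1 hl hm hA hB hlA hlB hD hN0
  obtain ⟨R01, R12, R20⟩ := stageN2 hl hm hA hB hlA hlB hA0 hD hN0
  set a0 := pderiv 0 A with ha0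
  set a1 := pderiv 1 A with ha1
  set a2 := pderiv 2 A with ha2
  set b0 := pderiv 0 B with hb0
  set b1 := pderiv 1 B with hb1
  set b2 := pderiv 2 B with hb2
  set ρ : RPoly := rhoP with hρ'
  set G : RPoly := gP A with hG'
  set H : RPoly := hP A B with hH'
  set Wq : RPoly := wq l A with hWq'
  set P₁ : RPoly := pone l m A B with hP₁'
  set P₂ : RPoly := ptwo l m A B with hP₂'
  have hρ : ρ = X 0 ^ 2 + X 1 ^ 2 + X 2 ^ 2 := by rw [hρ']; rfl
  have hG : G = a0 * a0 + a1 * a1 + a2 * a2 := by rw [hG', ha0, ha1, ha2]; rfl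
  have hH : H = a0 * b0 + a1 * b1 + a2 * b2 := by rw [hH', ha0, ha1, ha2, hb0, hb1, hb2]; rfl
  have hWq : Wq = ρ * G - C (l : ℝ) * C (l : ℝ) * A * A := by rw [hWq', hρ', hG']; rfl
  have hP₁ : P₁ = C (m : ℝ) * B * G - C (l : ℝ) * A * H := by rw [hP₁', hG', hH']; rfl
  have hP₂ : P₂ = ρ * H - C (l : ℝ) * C (m : ℝ) * A * B := by rw [hP₂', hρ', hH']; rfl
  have sa01 : pderiv 1 a0 = pderiv 0 a1 := by rw [ha0, ha1, pderiv_comm_real]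
  have sa02 : pderiv 2 a0 = pderiv 0 a2 := by rw [ha0, ha2, pderiv_comm_real]
  have sa12 : pderiv 2 a1 = pderiv 1 a2 := by rw [ha1, ha2, pderiv_comm_real]
  have sb01 : pderiv 1 b0 = pderiv 0 b1 := by rw [hb0, hb1, pderiv_comm_real]
  have sb02 : pderiv 2 b0 = pderiv 0 b2 := by rw [hb0, hb2, pderiv_comm_real]
  have sb12 : pderiv 2 b1 = pderiv 1 b2 := by rw [hb1, hb2, pderiv_comm_real]
  have lapA : pderiv 0 a0 + pderiv 1 a1 + pderiv 2 a2 = 0 := by rw [ha0, ha1, ha2]; exact hlA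
  have lapB : pderiv 0 b0 + pderiv 1 b1 + pderiv 2 b2 = 0 := by rw [hb0, hb1, hb2]; exact hlB
  have eA : X 0 * a0 + X 1 * a1 + X 2 * a2 = C (l : ℝ) * A := by rw [ha0, ha1, ha2, euler3 hA]
  have eB : X 0 * b0 + X 1 * b1 + X 2 * b2 = C (m : ℝ) * B := by rw [hb0, hb1, hb2, euler3 hB]
  have hD' : (X 1 * a2 - X 2 * a1) * b0 + (X 2 * a0 - X 0 * a2) * b1 + (X 0 * a1 - X 1 * a0) * b2 = 0 := by
    rw [ha0, ha1, ha2, hb0, hb1, hb2, ← detP_eq_w, hD]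
  have LdP : ∀ Q : RPoly, detP A Q = (X 1 * a2 - X 2 * a1) * pderiv 0 Q + (X 2 * a0 - X 0 * a2) * pderiv 1 Q
      + (X 0 * a1 - X 1 * a0) * pderiv 2 Q := fun Q => by rw [detP_eq_w]
  have dρ0 : pderiv 0 ρ = C (2 : ℝ) * X 0 := by
    rw [hρ]; simp only [map_add, Derivation.leibniz_pow, pderiv_X_self, smul_eq_mul]; simp; exact (map_ofNat C 2).symm
  have dρ1 : pderiv 1 ρ = C (2 : ℝ) * X 1 := by
    rw [hρ]; simp only [map_add, Derivation.leibniz_pow, pderiv_X_self, smul_eq_mul]; simp; exact (map_ofNat C 2).symm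
  have dρ2 : pderiv 2 ρ = C (2 : ℝ) * X 2 := by
    rw [hρ]; simp only [map_add, Derivation.leibniz_pow, pderiv_X_self, smul_eq_mul]; simp; exact (map_ofNat C 2).symm
  have hWq0 : Wq ≠ 0 := by
    rw [hWq, hρ, hG, ha0, ha1, ha2]; exact wq_ne_zero hA hl hlA hA0
  have hconst : (C (l : ℝ) * (C (l : ℝ) + 1) * (C (m : ℝ) * (C (m : ℝ) + 1)) : RPoly) ≠ 0 := by
    have hC : (C (l : ℝ) * (C (l : ℝ) + 1) * (C (m : ℝ) * (C (m : ℝ) + 1)) : RPoly) = C ((l : ℝ) * ((l : ℝ) + 1) * ((m : ℝ) * ((m : ℝ) + 1))) := by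
      simp only [map_mul, map_add, map_one]
    rw [hC]
    have h1 : (0 : ℝ) < l := by exact_mod_cast hl
    have h2 : (0 : ℝ) < m := by exact_mod_cast hm
    exact C_eq_zero.not.mpr (by positivity)
  have hcw : (C (l : ℝ) * (C (l : ℝ) + 1) * (C (m : ℝ) * (C (m : ℝ) + 1)) * Wq : RPoly) ≠ 0 := mul_ne_zero hconst hWq0
  -- (P): `A (∇B × x) = B (∇A × x)`
  have P01 : A * (b0 * X 1 - b1 * X 0) = B * (a0 * X 1 - a1 * X 0) := by
    have h : C (l : ℝ) * (C (l : ℝ) + 1) * (C (m : ℝ) * (C (m : ℝ) + 1)) * Wq * (A * (b0 * X 1 - b1 * X 0)) = C (l : ℝ) * (C (l : ℝ) + 1) * (C (m : ℝ) * (C (m : ℝ) + 1)) * Wq * (B * (a0 * X 1 - a1 * X 0)) := by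
      linear_combination (C (l : ℝ) * (C (l : ℝ) + 1)) * A * R01 - (C (l : ℝ) * (C (l : ℝ) + 1)) * (a0 * X 1 - a1 * X 0) * E1'
    exact mul_left_cancel₀ hcw h
  have P12 : A * (b1 * X 2 - b2 * X 1) = B * (a1 * X 2 - a2 * X 1) := by
    have h : C (l : ℝ) * (C (l : ℝ) + 1) * (C (m : ℝ) * (C (m : ℝ) + 1)) * Wq * (A * (b1 * X 2 - b2 * X 1)) = C (l : ℝ) * (C (l : ℝ) + 1) * (C (m : ℝ) * (C (m : ℝ) + 1)) * Wq * (B * (a1 * X 2 - a2 * X 1)) := by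
      linear_combination (C (l : ℝ) * (C (l : ℝ) + 1)) * A * R12 - (C (l : ℝ) * (C (l : ℝ) + 1)) * (a1 * X 2 - a2 * X 1) * E1'
    exact mul_left_cancel₀ hcw h
  have P20 : A * (b2 * X 0 - b0 * X 2) = B * (a2 * X 0 - a0 * X 2) := by
    have h : C (l : ℝ) * (C (l : ℝ) + 1) * (C (m : ℝ) * (C (m : ℝ) + 1)) * Wq * (A * (b2 * X 0 - b0 * X 2)) = C (l : ℝ) * (C (l : ℝ) + 1) * (C (m : ℝ) * (C (m : ℝ) + 1)) * Wq * (B * (a2 * X 0 - a0 * X 2)) := by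
      linear_combination (C (l : ℝ) * (C (l : ℝ) + 1)) * A * R20 - (C (l : ℝ) * (C (l : ℝ) + 1)) * (a2 * X 0 - a0 * X 2) * E1'
    exact mul_left_cancel₀ hcw h
  -- (P'): `ρ (A ∂ᵢB − B ∂ᵢA) = (m − l) A B xᵢ`
  have P'0 : ρ * (A * b0 - B * a0) = (C (m : ℝ) - C (l : ℝ)) * A * B * X 0 := by
    rw [hρ]; linear_combination X 1 * P01 - X 2 * P20 + X 0 * A * eB - X 0 * B * eA
  have P'1 : ρ * (A * b1 - B * a1) = (C (m : ℝ) - C (l : ℝ)) * A * B * X 1 := by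
    rw [hρ]; linear_combination X 2 * P12 - X 0 * P01 + X 1 * A * eB - X 1 * B * eA
  have P'2 : ρ * (A * b2 - B * a2) = (C (m : ℝ) - C (l : ℝ)) * A * B * X 2 := by
    rw [hρ]; linear_combination X 0 * P20 - X 1 * P12 + X 2 * A * eB - X 2 * B * eA
  -- divergence
  have d0 := congrArg (pderiv 0) P'0
  have d1 := congrArg (pderiv 1) P'1
  have d2 := congrArg (pderiv 2) P'2
  simp only [Derivation.leibniz, smul_eq_mul, pderiv_C, map_sub, pderiv_X_self, mul_zero, add_zero, sub_zero,
    dρ0, dρ1, dρ2] at d0 d1 d2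
  rw [← ha0, ← hb0] at d0
  rw [← ha1, ← hb1] at d1
  rw [← ha2, ← hb2] at d2
  have hC2 : (C (2 : ℝ) : RPoly) = 2 := map_ofNat C 2
  rw [hC2] at d0 d1 d2
  have key : (C (m : ℝ) - C (l : ℝ)) * (C (l : ℝ) + C (m : ℝ) + 1) * (A * B) = 0 := by
    linear_combination -(d0 + d1 + d2) + (2 - (C (m : ℝ) - C (l : ℝ))) * (A * eB - B * eA)
      + (-2 * (C (m : ℝ) - C (l : ℝ)) * B) * eA + ρ * A * lapB - ρ * B * lapA
  have hne : ((C (m : ℝ) - C (l : ℝ)) * (C (l : ℝ) + C (m : ℝ) + 1) : RPoly) ≠ 0 := by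
    have hC : ((C (m : ℝ) - C (l : ℝ)) * (C (l : ℝ) + C (m : ℝ) + 1) : RPoly) = C (((m : ℝ) - l) * ((l : ℝ) + m + 1)) := by
      simp only [map_mul, map_sub, map_add, map_one]
    rw [hC]
    refine C_eq_zero.not.mpr (mul_ne_zero ?_ ?_)
    · exact sub_ne_zero.mpr (by exact_mod_cast (Ne.symm hlm))
    · positivity
  rcases mul_eq_zero.mp ((mul_eq_zero.mp key).resolve_left hne) with h | h
  · exact hA0 h
  · exact hB0 h

/-- ★★ **MIXED-DEGREE BRACKET RIGIDITY, polynomial core**: two non-zero harmonic homogeneous polynomials on `ℝ³` of DIFFERENT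
degrees `l ≠ m` (`l, m ≥ 1`) with `det(x, ∇A, ∇B) ≡ 0` have `det(∇A, ∇|∇A|², x) ≡ 0` (`A` is det-zonal). -/
theorem dP_eq_zero_of_mixed_bracket (hl : 1 ≤ l) (hm : 1 ≤ m) (hlm : l ≠ m) (hA : A.IsHomogeneous l)
    (hB : B.IsHomogeneous m) (hlA : lapP A = 0) (hlB : lapP B = 0) (hA0 : A ≠ 0) (hB0 : B ≠ 0) (hD : detP A B = 0) :
    DP A = 0 := by
  have h9 := stageI9 hl hm hA hB hlA hlB hA0 hD
  rcases mul_eq_zero.mp h9 with h | h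
  · exact (stageN3 hl hm hlm hA hB hlA hlB hA0 hB0 hD h).elim
  · exact (mul_eq_zero.mp h).resolve_left rho_ne_zero

end Stages

end Summit.NavierStokesRegularity.NavierStokesRegularity.Theorems.PoloidalLiouville.HorizonTower.Zonal

end
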